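import Summits.RiemannHypothesis.RiemannHypothesis.Theorems.WeilParityOffLineParityDetectionLocLaplace
import HarnessLib

/-!
# The mirror-odd witness `f₀(a - t) - f₀(a + t)` (helper file for stub LOC)

Route `WeilParity`, crux `OffLineParityDetection` (item stmt-RiemannHypothesis-15431), line
`registered`, stub `stub_finiteDefectLocalisation` (LOC).  Pure real analysis, no zeta facts and
no definitions.  For a smooth compactly supported real profile `f₀` with `tsupport f₀ ⊆ [0, ∞)`
(so `f₀ = 0` off `(0, r]` for some `r`) and a half-width `a ≥ R := max r 0 + 1`, the function

  `o(t) = f₀(a - t) - f₀(a + t)`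

is a real-valued odd Weil test function supported in `[-a, a]` whose two pieces have disjoint
supports (`[a - r, a)` and `(-a, r - a]`), so that `∫ |o|² = 2 ∫₀^∞ f₀²`; its `L¹`-size
`∫|o| + ∫|o″| ≤ 2 (∫|f₀| + ∫|f₀″|)` does not depend on `a`; and its Weil transform is the
two-term exponential sum

  `ô(s) = e^{(s-1/2)a} ∫₀^∞ f₀(u) e^{-(s-1/2)u} du - e^{-(s-1/2)a} ∫₀^∞ f₀(u) e^{(s-1/2)u} du`

(`loc_weilMellin_reflect`, `loc_weilMellin_translate`).  This is `loc_oddWitness`.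
-/

set_option linter.dupNamespace false

noncomputable section

namespace Summit.RiemannHypothesis.RiemannHypothesis.Theorems.WeilParityOffLineParityDetection

open MeasureTheory Set Filter
open scoped ComplexConjugate
open Literature.NumberTheory.LFunctions

/-- The Weil transform of a difference of continuous compactly supported functions. [folklore] -/
theorem loc_weilMellin_sub {g h : ℝ → ℂ} (hg : Continuous g) (hg' : HasCompactSupport g)
    (hh : Continuous h) (hh' : HasCompactSupport h) (s : ℂ) :
    weilMellin (fun t ↦ g t - h t) s = weilMellin g s - weilMellin h s := by
  unfold weilMellin
  rw [← integral_sub (integrable_weilIntegrand hg hg' s) (integrable_weilIntegrand hh hh' s)]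
  congr 1 with t
  ring

/-- Translates and reflected translates of an integrable real function are integrable, and their
integrals over `ℝ` add up to twice the integral. [folklore] -/
theorem loc_integral_reflect_add_translate {F : ℝ → ℝ} (hF : Integrable F) (a : ℝ) :
    Integrable (fun t ↦ F (a - t) + F (a + t)) ∧
      ∫ t, F (a - t) + F (a + t) = 2 * ∫ u, F u := by
  have h1 : Integrable fun t ↦ F (a - t) := hF.comp_sub_left a
  have h2 : Integrable fun t ↦ F (a + t) := hF.comp_add_left a
  refine ⟨h1.add h2, ?_⟩
  rw [integral_add h1 h2, integral_sub_left_eq_self F volume a,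
    integral_add_left_eq_self (μ := volume) F a]
  ring

/-- **The mirror-odd witness.**  For a smooth compactly supported real profile `f₀` with
`tsupport f₀ ⊆ [0, ∞)` there are `R ≥ 1` and `L` such that for every `a ≥ R` the function
`o(t) = f₀(a - t) - f₀(a + t)` is a real odd Weil test function supported in `[-a, a]` with
`∫ |o|² = 2 ∫₀^∞ f₀²`, `∫ |o| + ∫ |o″| ≤ L`, and
`ô(s) = e^{(s-1/2)a} ∫₀^∞ f₀(u) e^{-(s-1/2)u} du - e^{-(s-1/2)a} ∫₀^∞ f₀(u) e^{(s-1/2)u} du`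
for every `s` (registered sub-goal of the item, closed form). [folklore] -/
theorem loc_oddWitness :
    ∀ (f₀ : ℝ → ℝ), ContDiff ℝ (⊤ : ℕ∞) f₀ → HasCompactSupport f₀ → tsupport f₀ ⊆ Set.Ici 0 →
      ∃ R L : ℝ, 1 ≤ R ∧ ∀ a : ℝ, R ≤ a → ∀ o : ℝ → ℂ,
      (∀ t, o t = ((f₀ (a - t) - f₀ (a + t) : ℝ) : ℂ)) →
      IsWeilTest o ∧ tsupport o ⊆ Set.Icc (-a) a ∧ (∀ t, o (-t) = -o t) ∧ (∀ t, (o t).im = 0) ∧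
      ∫ t, ‖o t‖ ^ 2 = 2 * ∫ u in Set.Ioi (0 : ℝ), f₀ u ^ 2 ∧
      (∫ t, ‖o t‖) + ∫ t, ‖deriv (deriv o) t‖ ≤ L ∧
      ∀ s : ℂ, weilMellin o s =
        Complex.exp ((s - 1 / 2) * (a : ℂ)) *
            (∫ u in Set.Ioi (0 : ℝ), (f₀ u : ℂ) * Complex.exp (-((s - 1 / 2) * (u : ℂ)))) -
          Complex.exp (-((s - 1 / 2) * (a : ℂ))) *
            ∫ u in Set.Ioi (0 : ℝ), (f₀ u : ℂ) * Complex.exp ((s - 1 / 2) * (u : ℂ)) := by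
  intro f₀ hf hc hs
  obtain ⟨r, hr⟩ := hc.isCompact.isBounded.subset_closedBall 0
  have hfc : Continuous f₀ := hf.continuous
  have hf0 : ∀ u ≤ 0, f₀ u = 0 := fun u hu ↦ loc_profile_eq_zero hfc hs hu
  have hfr : ∀ u, r < u → f₀ u = 0 := fun u hu ↦ image_eq_zero_of_notMem_tsupport fun h ↦ by
    have h' := hr h
    rw [Metric.mem_closedBall, dist_zero_right, Real.norm_eq_abs] at h'
    linarith [le_abs_self u]
  -- derivatives of `f₀`
  have hf1 : ContDiff ℝ (⊤ : ℕ∞) (deriv f₀) := hf.deriv'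
  have hf2 : ContDiff ℝ (⊤ : ℕ∞) (deriv (deriv f₀)) := hf1.deriv'
  have hd : ∀ u, HasDerivAt f₀ (deriv f₀ u) u := fun u ↦
    (hf.differentiable (by simp) u).hasDerivAt
  have hd' : ∀ u, HasDerivAt (deriv f₀) (deriv (deriv f₀) u) u := fun u ↦
    (hf1.differentiable (by simp) u).hasDerivAt
  -- integrability of `|f₀|`, `|f₀''|`, `f₀²`
  have hI : Integrable fun u ↦ ‖f₀ u‖ := hfc.norm.integrable_of_hasCompactSupport hc.norm
  have hI2 : Integrable fun u ↦ ‖deriv (deriv f₀) u‖ :=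
    hf2.continuous.norm.integrable_of_hasCompactSupport hc.deriv.deriv.norm
  have hc2 : HasCompactSupport (fun u ↦ f₀ u ^ 2) :=
    hc.comp_left (g := fun x : ℝ ↦ x ^ 2) (zero_pow two_ne_zero)
  have hIsq : Integrable fun u ↦ f₀ u ^ 2 := (hfc.pow 2).integrable_of_hasCompactSupport hc2
  refine ⟨max r 0 + 1, 2 * ((∫ u, ‖f₀ u‖) + ∫ u, ‖deriv (deriv f₀) u‖),
    by linarith [le_max_right r 0], fun a ha o ho ↦ ?_⟩
  have har : r < a := by linarith [le_max_left r 0]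
  have ha0 : 0 < a := by linarith [le_max_right r 0]
  -- the real profile of `o` and its first two derivatives (kept opaque)
  obtain ⟨p, hp⟩ : ∃ p : ℝ → ℝ, ∀ t, p t = f₀ (a - t) - f₀ (a + t) := ⟨_, fun t ↦ rfl⟩
  obtain ⟨p₁, hp₁⟩ : ∃ p₁ : ℝ → ℝ, ∀ t, p₁ t = -deriv f₀ (a - t) - deriv f₀ (a + t) :=
    ⟨_, fun t ↦ rfl⟩
  obtain ⟨p₂, hp₂⟩ : ∃ p₂ : ℝ → ℝ,
      ∀ t, p₂ t = deriv (deriv f₀) (a - t) - deriv (deriv f₀) (a + t) := ⟨_, fun t ↦ rfl⟩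
  have hpf : p = fun t ↦ f₀ (a - t) - f₀ (a + t) := funext hp
  have hp₁f : p₁ = fun t ↦ -deriv f₀ (a - t) - deriv f₀ (a + t) := funext hp₁
  have hop : o = fun t ↦ ((p t : ℝ) : ℂ) := funext fun t ↦ by rw [ho t, hp t]
  have hpd : ∀ t, HasDerivAt p (p₁ t) t := fun t ↦ by
    have h : HasDerivAt (fun x ↦ f₀ (a - x) - f₀ (a + x))
        (deriv f₀ (a - t) * (-1) - deriv f₀ (a + t) * 1) t :=
      ((hd (a - t)).comp t ((hasDerivAt_id' t).const_sub a)).sub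
        ((hd (a + t)).comp t ((hasDerivAt_id' t).const_add a))
    rw [hpf, hp₁ t]
    exact h.congr_deriv (by ring)
  have hp₁d : ∀ t, HasDerivAt p₁ (p₂ t) t := fun t ↦ by
    have h : HasDerivAt (fun x ↦ -deriv f₀ (a - x) - deriv f₀ (a + x))
        (-(deriv (deriv f₀) (a - t) * (-1)) - deriv (deriv f₀) (a + t) * 1) t :=
      ((hd' (a - t)).comp t ((hasDerivAt_id' t).const_sub a)).neg.sub
        ((hd' (a + t)).comp t ((hasDerivAt_id' t).const_add a))
    rw [hp₁f, hp₂ t]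
    exact h.congr_deriv (by ring)
  have hod : ∀ t, HasDerivAt o ((p₁ t : ℝ) : ℂ) t := by
    rw [hop]
    exact fun t ↦ (hpd t).ofReal_comp
  have hdo : deriv o = fun t ↦ ((p₁ t : ℝ) : ℂ) := funext fun t ↦ (hod t).deriv
  have hodd' : ∀ t, HasDerivAt (deriv o) ((p₂ t : ℝ) : ℂ) t := by
    rw [hdo]
    exact fun t ↦ (hp₁d t).ofReal_comp
  have hddo : deriv (deriv o) = fun t ↦ ((p₂ t : ℝ) : ℂ) := funext fun t ↦ (hodd' t).deriv
  -- the two pieces never overlap (`a > r`), and `o` lives on `[-a, a]`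
  have hprod : ∀ t, f₀ (a - t) * f₀ (a + t) = 0 := fun t ↦ by
    rcases le_or_gt 0 t with ht | ht
    · rw [hfr (a + t) (by linarith), mul_zero]
    · rw [hfr (a - t) (by linarith), zero_mul]
  have ho0 : ∀ t, t ∉ Icc (-a) a → o t = 0 := fun t ht ↦ by
    rw [ho t, Complex.ofReal_eq_zero]
    simp only [mem_Icc, not_and_or, not_le] at ht
    rcases ht with h | h
    · rw [hfr (a - t) (by linarith), hf0 (a + t) (by linarith), sub_zero]
    · rw [hf0 (a - t) (by linarith), hfr (a + t) (by linarith), sub_zero]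
  have hps : ContDiff ℝ (⊤ : ℕ∞) p := by
    rw [hpf]
    exact (hf.comp (contDiff_const.sub contDiff_id)).sub
      (hf.comp (contDiff_const.add contDiff_id))
  have hoW : IsWeilTest o := by
    refine ⟨?_, HasCompactSupport.intro isCompact_Icc ho0⟩
    rw [hop]
    exact Complex.ofRealCLM.contDiff.comp hps
  have hsupp : tsupport o ⊆ Icc (-a) a := loc_tsupport_subset isClosed_Icc ho0
  have hnorm : ∀ t, ‖o t‖ = ‖p t‖ := fun t ↦ by
    rw [hop, Complex.norm_real]
  refine ⟨hoW, hsupp, fun t ↦ ?_, fun t ↦ ?_, ?_, ?_, fun s ↦ ?_⟩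
  · -- odd
    rw [ho, ho, show a - -t = a + t by ring, show a + -t = a - t by ring]
    push_cast
    ring
  · -- real
    rw [ho t, Complex.ofReal_im]
  · -- `∫ |o|² = 2 ∫₀^∞ f₀²`
    have h1 : ∀ t, ‖o t‖ ^ 2 = f₀ (a - t) ^ 2 + f₀ (a + t) ^ 2 := fun t ↦ by
      rw [ho t, Complex.norm_real, Real.norm_eq_abs, sq_abs]
      linear_combination (-2 : ℝ) * hprod t
    simp_rw [h1]
    rw [(loc_integral_reflect_add_translate hIsq a).2,
      ← setIntegral_eq_integral_of_forall_compl_eq_zero (s := Ioi (0 : ℝ)) (fun u hu ↦ by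
        rw [hf0 u (not_lt.1 hu), zero_pow two_ne_zero])]
  · -- `∫ |o| + ∫ |o''| ≤ L`
    have hA : ∫ t, ‖o t‖ ≤ 2 * ∫ u, ‖f₀ u‖ := by
      rw [← (loc_integral_reflect_add_translate hI a).2]
      refine integral_mono (hoW.1.continuous.norm.integrable_of_hasCompactSupport hoW.2.norm)
        (loc_integral_reflect_add_translate hI a).1 fun t ↦ ?_
      rw [hnorm, hp t]
      exact norm_sub_le _ _
    have hB : ∫ t, ‖deriv (deriv o) t‖ ≤ 2 * ∫ u, ‖deriv (deriv f₀) u‖ := by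
      have hW2 : IsWeilTest (deriv (deriv o)) := hoW.deriv.deriv
      rw [← (loc_integral_reflect_add_translate hI2 a).2]
      refine integral_mono (hW2.1.continuous.norm.integrable_of_hasCompactSupport hW2.2.norm)
        (loc_integral_reflect_add_translate hI2 a).1 fun t ↦ ?_
      rw [hddo]
      dsimp only
      rw [Complex.norm_real, hp₂ t]
      exact norm_sub_le _ _
    linarith
  · -- the transform
    have e1 : o = fun t ↦ (fun t ↦ ((f₀ (a - t) : ℝ) : ℂ)) t - (fun t ↦ ((f₀ (a + t) : ℝ) : ℂ)) t := by
      funext t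
      rw [ho t]
      push_cast
      rfl
    have hc1 : HasCompactSupport fun t ↦ ((f₀ (a - t) : ℝ) : ℂ) :=
      (hc.comp_homeomorph (Homeomorph.subLeft a)).comp_left Complex.ofReal_zero
    have hc2 : HasCompactSupport fun t ↦ ((f₀ (a + t) : ℝ) : ℂ) :=
      (hc.comp_homeomorph (Homeomorph.addLeft a)).comp_left Complex.ofReal_zero
    rw [e1, loc_weilMellin_sub (by fun_prop) hc1 (by fun_prop) hc2,
      loc_weilMellin_reflect f₀ hf0 a s, loc_weilMellin_translate f₀ hf0 a s]

end Summit.RiemannHypothesis.RiemannHypothesis.Theorems.WeilParityOffLineParityDetection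

end
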